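import Mathlib
import HarnessLib
import Summits.Ventures.LatticeQCDFlow.Scoring.QuantileBand
import Summits.Ventures.LatticeQCDFlow.Scoring.DeltaMethod

/-!
# The printed STANDARD ERROR of a sample quantile is consistent: the Siddiqui–Bloch–Gastwirth
# spacing estimator `ŝₙ = (q̂ₙ(u + hₙ) − q̂ₙ(u − hₙ))/(2hₙ)` of the quantile density `1/f(q)`
# converges in probability when `hₙ → 0`, `n·hₙ² → ∞`, hence `n·V̂ₙ → u(1−u)/f²` in probability for
# the plug-in squared standard error `V̂ₙ = u(1−u)·ŝₙ²/n`

HONEST FRAMING: exact (Metropolis-corrected) sampling algorithms for lattice gauge theory;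
figures of merit are autocorrelation/cost numbers at stated couplings and volumes; no
continuum-physics claim.

Venture `LatticeQCDFlow` (cell pub-lqcd), topic `Scoring`; FANOUT row 4 (`s0-u1-b`, rung S0-B).
A card prints a MEDIAN or a percentile of a statistic together with an error bar, and the
two-code agreement criterion for a quantile column (row 4's `QuantileAgreement`) takes as a
HYPOTHESIS that each code's printed squared standard error `V̂ₙ` is consistent in probability,
`n·V̂ₙ → u(1−u)/f(q)²`.  This file DISCHARGES that hypothesis for the classical plug-in error bar:
the asymptotic variance of the sample `u`-quantile is `u(1−u)/(n f(q)²)`, `f(q) = F′(q)` the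
density at the quantile, and `1/f(q)` — the QUANTILE DENSITY (the derivative of the quantile
function: `Scoring/QuantileDensity.hasDerivAt_lowerQuantile`, a sibling file, not imported) — is
estimated by the symmetric spacing of two empirical quantiles,
`ŝₙ = (q̂ₙ(u + hₙ) − q̂ₙ(u − hₙ))/(2hₙ)` (Siddiqui 1960; Bloch–Gastwirth 1968, NAMED ONLY — nothing
is cited as a fact).  **`quantileSpacing_tendstoInMeasure`**: for iid real
`Xᵢ` whose distribution function `F` has `F(q) = u ∈ (0,1)` and derivative `f > 0` at `q`, and a
bandwidth `hₙ > 0` with `hₙ → 0` and `n·hₙ² → ∞`, `ŝₙ → 1/f` in probability; the proof is four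
Hoeffding inequalities for the empirical distribution function at the deterministic points
`q ± (1 ± δ)hₙ/f`, turned into brackets for the two empirical quantiles by the Galois connection
`q̂ₙ(v) ≤ b ↔ v ≤ F̂ₙ(b)`, with the explicit failure probability `4·e^{−n δ² hₙ²/2}`.
**`sampleQuantile_pluginVariance_tendstoInMeasure`**: `n·(u(1−u)ŝₙ²/n) → u(1−u)/f²` in
probability — the exact shape of the hypothesis of the quantile agreement test.
NEW WORK of the cell (our formalisation); no definition is introduced.

## Content

(`F = cdf ρ`, `ρ = P ∘ X₀⁻¹`, `F̂ₙ(x) = #{i<n : Xᵢ ≤ x}/n`, `q̂ₙ(v) = inf{x : v ≤ F̂ₙ(x)}`.)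


* `measureReal_edf_sub_cdf_ge_le` — Hoeffding, upper deviation of `F̂ₙ` at a point
  (companion of `GlivenkoCantelliRate.measureReal_cdf_sub_edf_ge_le`);
* `edfQuantile_le_iff`, `edfQuantile_bracket` — the Galois connection for the empirical
  quantile and the resulting brackets; `abs_spacing_div_sub_inv_lt`,
  `abs_spacing_sub_inv_lt_of_deviations` — the deterministic core (reused along chains);
* **`quantileSpacing_tendstoInMeasure`** — consistency of the spacing estimator;
* **`sampleQuantile_pluginVariance_tendstoInMeasure`** — `n·V̂ₙ →ₚ u(1−u)/f²`.

NOT CLAIMED: the weaker bandwidth condition `n·hₙ → ∞` (which needs the oscillation modulus of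
the empirical process rather than pointwise Hoeffding bounds); a rate or the optimal bandwidth
`hₙ ∼ n^{−1/5}`; kernel quantile-density estimators; the bootstrap; dependent (Markov-chain)
samples; the reweighted card's quantiles; any number of ours re-scored.
-/

noncomputable section

namespace Summit.Ventures.LatticeQCDFlow.Scoring.GlivenkoCantelli

open MeasureTheory ProbabilityTheory Finset Filter Function
open scoped Topology ENNReal

/-! ## §1 Hoeffding at a point (upper deviation) and the empirical Galois connection -/

section Point

variable {Ω : Type*} [MeasurableSpace Ω] {P : Measure Ω} [IsProbabilityMeasure P] {X : ℕ → Ω → ℝ}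

/-- **Upper deviation of the empirical distribution function at a point**: iid `Xᵢ` with law
`ρ = P ∘ X₀⁻¹`, `F = cdf ρ`, `δ ≥ 0`, `n ≥ 1`:
`P(δ ≤ #{i<n : Xᵢ ≤ u}/n − F(u)) ≤ e^{−2nδ²}`. [ours] (Hoeffding for the `[0,1]`-valued
indicators `1{Xᵢ ≤ u}`, whose mean is `F(u)`; companion of
`measureReal_cdf_sub_edf_ge_le`) -/
theorem measureReal_edf_sub_cdf_ge_le (hXm : ∀ i, Measurable (X i)) (hind : iIndepFun X P)
    (hid : ∀ i, IdentDistrib (X i) (X 0) P P) (u : ℝ) {δ : ℝ} (hδ : 0 ≤ δ) {n : ℕ} (hn : 1 ≤ n) :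
    P.real {ω | δ ≤ (∑ i ∈ range n, (Set.Iic u).indicator (1 : ℝ → ℝ) (X i ω)) / n
        - cdf (P.map (X 0)) u}
      ≤ Real.exp (-(2 * n * δ ^ 2)) := by
  haveI : IsProbabilityMeasure (P.map (X 0)) :=
    Measure.isProbabilityMeasure_map (hXm 0).aemeasurable
  have hIm : Measurable ((Set.Iic u).indicator (1 : ℝ → ℝ)) :=
    measurable_one.indicator measurableSet_Iic
  set Y : ℕ → Ω → ℝ := fun i ω => (Set.Iic u).indicator (1 : ℝ → ℝ) (X i ω) with hY
  have hYm : ∀ i, AEMeasurable (Y i) P := fun i => (hIm.comp (hXm i)).aemeasurable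
  have hYind : iIndepFun Y P := hind.comp (fun _ x => (Set.Iic u).indicator (1 : ℝ → ℝ) x)
    fun _ => hIm
  have hYb : ∀ i, ∀ᵐ ω ∂P, Y i ω ∈ Set.Icc (0 : ℝ) 1 := fun i =>
    ae_of_all _ fun ω => ⟨indicator_one_nonneg _ _, indicator_one_le_one _ _⟩
  have hYmean : ∀ i, ∫ ω, Y i ω ∂P ≤ cdf (P.map (X 0)) u := by
    intro i
    have e : ∫ ω, Y i ω ∂P = (P.map (X 0)).real (Set.Iic u) := by
      rw [hY]
      simp only []
      rw [← integral_map (hXm i).aemeasurable hIm.aestronglyMeasurable, (hid i).map_eq]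
      exact integral_indicator_one measurableSet_Iic
    rw [e, cdf_eq_real]
  have hH := Literature.Probability.Moments.measureReal_le_sum_le_exp_of_integral_le hYind hYm
    (a := 0) (b := 1) hYb hYmean hδ (range n)
  rw [Finset.card_range] at hH
  have hn0 : (0 : ℝ) < n := by exact_mod_cast hn
  have hsub : {ω | δ ≤ (∑ i ∈ range n, (Set.Iic u).indicator (1 : ℝ → ℝ) (X i ω)) / n
      - cdf (P.map (X 0)) u}
      ⊆ {ω | (n : ℝ) * (cdf (P.map (X 0)) u + δ) ≤ ∑ i ∈ range n, Y i ω} := by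
    intro ω hω
    simp only [Set.mem_setOf_eq] at hω ⊢
    have h1 : cdf (P.map (X 0)) u + δ
        ≤ (∑ i ∈ range n, (Set.Iic u).indicator (1 : ℝ → ℝ) (X i ω)) / n := by linarith
    have h2 := (le_div_iff₀ hn0).1 h1
    rw [mul_comm]
    exact h2
  refine (measureReal_mono hsub (measure_ne_top P _)).trans (hH.trans (le_of_eq ?_))
  congr 1
  ring

/-- **The Galois connection for the empirical quantile**: for `n ≥ 1` points and a level
`v ∈ (0,1)`, `inf{x : v ≤ #{i<n : xᵢ ≤ x}/n} ≤ b ↔ v ≤ #{i<n : xᵢ ≤ b}/n`. [folklore] (the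
empirical distribution function is the distribution function of the empirical measure,
`QuantileBand.cdf_empiricalMeasure`, and `GlivenkoCantelliSandwich.cdf_quantile_spec`) -/
theorem edfQuantile_le_iff (x : ℕ → ℝ) {n : ℕ} (hn : 1 ≤ n) {v : ℝ} (hv0 : 0 < v) (hv1 : v < 1)
    (b : ℝ) :
    sInf {t | v ≤ (∑ i ∈ range n, (Set.Iic t).indicator (1 : ℝ → ℝ) (x i)) / n} ≤ b
      ↔ v ≤ (∑ i ∈ range n, (Set.Iic b).indicator (1 : ℝ → ℝ) (x i)) / n := by
  haveI := isProbabilityMeasure_empiricalMeasure x hn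
  have hset : {t | v ≤ (∑ i ∈ range n, (Set.Iic t).indicator (1 : ℝ → ℝ) (x i)) / n}
      = {t | v ≤ cdf (((n : ℝ≥0∞)⁻¹) • ∑ i ∈ range n, Measure.dirac (x i)) t} := by
    ext t
    rw [Set.mem_setOf_eq, Set.mem_setOf_eq, cdf_empiricalMeasure x hn t]
  obtain ⟨-, -, hgal⟩ :=
    cdf_quantile_spec (((n : ℝ≥0∞)⁻¹) • ∑ i ∈ range n, Measure.dirac (x i)) hv0 hv1
  rw [hset, hgal b, cdf_empiricalMeasure x hn b]

end Point

/-! ## §2 Consistency of the spacing estimator of the quantile density -/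

section Spacing

variable {Ω : Type*} [MeasurableSpace Ω] {P : Measure Ω} [IsProbabilityMeasure P] {X : ℕ → Ω → ℝ}

/-- **Brackets for an empirical quantile from two values of the empirical distribution
function**: `n ≥ 1`, `v ∈ (0,1)`; if `#{i<n : xᵢ ≤ b}/n ≥ v` and `#{i<n : xᵢ ≤ a}/n < v` then
`a < q̂ₙ(v) ≤ b`. [folklore] (the Galois connection `edfQuantile_le_iff` twice) -/
theorem edfQuantile_bracket (x : ℕ → ℝ) {n : ℕ} (hn : 1 ≤ n) {v : ℝ} (hv0 : 0 < v) (hv1 : v < 1)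
    {a b : ℝ} (hb : v ≤ (∑ i ∈ range n, (Set.Iic b).indicator (1 : ℝ → ℝ) (x i)) / n)
    (ha : (∑ i ∈ range n, (Set.Iic a).indicator (1 : ℝ → ℝ) (x i)) / n < v) :
    a < sInf {t | v ≤ (∑ i ∈ range n, (Set.Iic t).indicator (1 : ℝ → ℝ) (x i)) / n}
      ∧ sInf {t | v ≤ (∑ i ∈ range n, (Set.Iic t).indicator (1 : ℝ → ℝ) (x i)) / n} ≤ b := by
  refine ⟨?_, (edfQuantile_le_iff x hn hv0 hv1 b).2 hb⟩
  by_contra hle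
  exact absurd ((edfQuantile_le_iff x hn hv0 hv1 a).1 (not_lt.1 hle)) (not_le.2 ha)

/-- **Arithmetic of the spacing**: if `q + (1−δ)η/f < Q⁺ ≤ q + (1+δ)η/f` and
`q − (1+δ)η/f < Q⁻ ≤ q − (1−δ)η/f` with `f, η > 0` and `δ/f ≤ ε`, then
`|(Q⁺ − Q⁻)/(2η) − 1/f| < ε`. [ours] -/
theorem abs_spacing_div_sub_inv_lt {Qp Qm q f δ η ε : ℝ} (hη : 0 < η)
    (hδε : δ / f ≤ ε) (h1 : Qp ≤ q + (1 + δ) / f * η) (h2 : q + (1 - δ) / f * η < Qp)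
    (h3 : Qm ≤ q + -(1 - δ) / f * η) (h4 : q + -(1 + δ) / f * η < Qm) :
    |(Qp - Qm) / (2 * η) - 1 / f| < ε := by
  have h2η : (0 : ℝ) < 2 * η := by positivity
  have hup : (Qp - Qm) / (2 * η) < (1 + δ) / f := by
    rw [div_lt_iff₀ h2η]
    have e : (1 + δ) / f * (2 * η) = (q + (1 + δ) / f * η) - (q + -(1 + δ) / f * η) := by ring
    rw [e]
    linarith
  have hdown : (1 - δ) / f < (Qp - Qm) / (2 * η) := by
    rw [lt_div_iff₀ h2η]
    have e : (1 - δ) / f * (2 * η) = (q + (1 - δ) / f * η) - (q + -(1 - δ) / f * η) := by ring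
    rw [e]
    linarith
  have ep : (1 + δ) / f = 1 / f + δ / f := by ring
  have em : (1 - δ) / f = 1 / f - δ / f := by ring
  rw [abs_sub_lt_iff]
  constructor <;> linarith

/-- **The spacing estimator is `ε`-close to `1/f` outside four one-point deviation events**
(deterministic).  Points `x : ℕ → ℝ`, `n ≥ 1`, empirical distribution function
`E(t) = #{i<n : xᵢ ≤ t}/n` and quantiles `Q(v) = inf{t : v ≤ E(t)}`; a function `F`, a level `u`,
a bandwidth `η > 0` with `0 < u − η`, `u + η < 1`, a precision `0 < δ` with `δ/f ≤ ε`; the four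
points `q + c·η/f`, `c = ±(1 ± δ)`, carry the first-order bounds `|F − u − cη| ≤ δη/4` and the
deviations `F − E < δη/2` (at `c = 1+δ, −(1−δ)`) and `E − F < δη/2` (at `c = 1−δ, −(1+δ)`).  Then
`|(Q(u+η) − Q(u−η))/(2η) − 1/f| < ε`. [ours] -/
theorem abs_spacing_sub_inv_lt_of_deviations (x : ℕ → ℝ) {n : ℕ} (hn : 1 ≤ n) (F : ℝ → ℝ)
    {u q f δ η ε : ℝ} (hη : 0 < η) (hδ : 0 < δ) (hδε : δ / f ≤ ε) (hu0 : 0 < u - η)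
    (hu1 : u + η < 1)
    (h1 : |F (q + (1 + δ) / f * η) - u - (1 + δ) * η| ≤ δ * η / 4)
    (h2 : |F (q + (1 - δ) / f * η) - u - (1 - δ) * η| ≤ δ * η / 4)
    (h3 : |F (q + -(1 - δ) / f * η) - u - -(1 - δ) * η| ≤ δ * η / 4)
    (h4 : |F (q + -(1 + δ) / f * η) - u - -(1 + δ) * η| ≤ δ * η / 4)
    (g1 : F (q + (1 + δ) / f * η) - (∑ i ∈ range n,
      (Set.Iic (q + (1 + δ) / f * η)).indicator (1 : ℝ → ℝ) (x i)) / n < δ * η / 2)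
    (g2 : (∑ i ∈ range n, (Set.Iic (q + (1 - δ) / f * η)).indicator (1 : ℝ → ℝ) (x i)) / n
      - F (q + (1 - δ) / f * η) < δ * η / 2)
    (g3 : F (q + -(1 - δ) / f * η) - (∑ i ∈ range n,
      (Set.Iic (q + -(1 - δ) / f * η)).indicator (1 : ℝ → ℝ) (x i)) / n < δ * η / 2)
    (g4 : (∑ i ∈ range n, (Set.Iic (q + -(1 + δ) / f * η)).indicator (1 : ℝ → ℝ) (x i)) / n
      - F (q + -(1 + δ) / f * η) < δ * η / 2) :
    |(sInf {t | u + η ≤ (∑ i ∈ range n, (Set.Iic t).indicator (1 : ℝ → ℝ) (x i)) / n}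
        - sInf {t | u - η ≤ (∑ i ∈ range n, (Set.Iic t).indicator (1 : ℝ → ℝ) (x i)) / n})
        / (2 * η) - 1 / f| < ε := by
  have hx1 : (1 + δ) * η = η + δ * η := by ring
  have hx2 : (1 - δ) * η = η - δ * η := by ring
  have hx3 : -(1 - δ) * η = -η + δ * η := by ring
  have hx4 : -(1 + δ) * η = -η - δ * η := by ring
  have hδη : 0 < δ * η := by positivity
  have k1 : u + η ≤ (∑ i ∈ range n,
      (Set.Iic (q + (1 + δ) / f * η)).indicator (1 : ℝ → ℝ) (x i)) / n := by
    linarith [(abs_le.1 h1).1, g1, hx1, hδη.le]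
  have k2 : (∑ i ∈ range n,
      (Set.Iic (q + (1 - δ) / f * η)).indicator (1 : ℝ → ℝ) (x i)) / n < u + η := by
    linarith [(abs_le.1 h2).2, g2, hx2, hδη]
  have k3 : u - η ≤ (∑ i ∈ range n,
      (Set.Iic (q + -(1 - δ) / f * η)).indicator (1 : ℝ → ℝ) (x i)) / n := by
    linarith [(abs_le.1 h3).1, g3, hx3, hδη.le]
  have k4 : (∑ i ∈ range n,
      (Set.Iic (q + -(1 + δ) / f * η)).indicator (1 : ℝ → ℝ) (x i)) / n < u - η := by
    linarith [(abs_le.1 h4).2, g4, hx4, hδη]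
  obtain ⟨bp2, bp1⟩ := edfQuantile_bracket x hn (v := u + η) (by linarith) hu1 k1 k2
  obtain ⟨bm2, bm1⟩ := edfQuantile_bracket x hn (v := u - η) hu0 (by linarith) k3 k4
  exact abs_spacing_div_sub_inv_lt hη hδε bp1 bp2 bm1 bm2

/-- **CONSISTENCY OF THE SIDDIQUI–BLOCH–GASTWIRTH SPACING ESTIMATOR.**  iid real `Xᵢ` with law
`ρ = P ∘ X₀⁻¹` and distribution function `F = cdf ρ`; a level `u ∈ (0,1)` and a point `q` with
`F(q) = u` at which `F` has derivative `f > 0`; a bandwidth `hₙ > 0` with `hₙ → 0` and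
`n·hₙ² → ∞`.  With the empirical quantiles `q̂ₙ(v) = inf{x : v ≤ #{i<n : Xᵢ ≤ x}/n}`, the
spacing estimator `ŝₙ = (q̂ₙ(u + hₙ) − q̂ₙ(u − hₙ))/(2hₙ)` converges IN PROBABILITY to the
quantile density `1/f`. [ours] (for `δ = min(½, εf)` and large `n`, outside four Hoeffding
events of total probability `≤ 4e^{−nδ²hₙ²/2}` the brackets
`q + (1−δ)hₙ/f < q̂ₙ(u+hₙ) ≤ q + (1+δ)hₙ/f`, `q − (1+δ)hₙ/f < q̂ₙ(u−hₙ) ≤ q − (1−δ)hₙ/f` hold, so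
`|ŝₙ − 1/f| < δ/f ≤ ε`) -/
theorem quantileSpacing_tendstoInMeasure (hXm : ∀ i, Measurable (X i)) (hind : iIndepFun X P)
    (hid : ∀ i, IdentDistrib (X i) (X 0) P P) {u q f : ℝ} (hu0 : 0 < u) (hu1 : u < 1)
    (hFq : cdf (P.map (X 0)) q = u) (hder : HasDerivAt (cdf (P.map (X 0))) f q) (hf : 0 < f)
    {h : ℕ → ℝ} (hh0 : ∀ n, 0 < h n) (hh : Tendsto h atTop (𝓝 0))
    (hnh : Tendsto (fun n : ℕ => (n : ℝ) * h n ^ 2) atTop atTop) :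
    TendstoInMeasure P (fun (n : ℕ) ω =>
        (sInf {x | u + h n ≤ (∑ i ∈ range n, (Set.Iic x).indicator (1 : ℝ → ℝ) (X i ω)) / n}
          - sInf {x | u - h n ≤ (∑ i ∈ range n, (Set.Iic x).indicator (1 : ℝ → ℝ) (X i ω)) / n})
          / (2 * h n)) atTop (fun _ => 1 / f) := by
  rw [tendstoInMeasure_iff_norm]
  intro ε hε
  -- the relative precision `δ`
  set δ : ℝ := min (1 / 2) (ε * f) with hδdef
  have hδ0 : 0 < δ := lt_min (by norm_num) (mul_pos hε hf)
  have hδ1 : δ ≤ 1 / 2 := min_le_left _ _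
  have hδε : δ / f ≤ ε := by
    rw [div_le_iff₀ hf]
    exact min_le_right _ _
  have hf0 : f ≠ 0 := hf.ne'
  -- first-order expansion of `F` at the points `q + (c/f)·hₙ`, `|c| ≤ 2`
  have hexp : ∀ c : ℝ, |c| ≤ 2 → ∀ᶠ n in atTop,
      |cdf (P.map (X 0)) (q + c / f * h n) - u - c * h n| ≤ δ * h n / 4 := by
    intro c hc
    have hlo := (hasDerivAt_iff_isLittleO.1 hder).def (show (0 : ℝ) < δ * f / 8 by positivity)
    have htend : Tendsto (fun n => q + c / f * h n) atTop (𝓝 q) := by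
      simpa using (hh.const_mul (c / f)).const_add q
    filter_upwards [htend.eventually hlo] with n hn
    rw [hFq] at hn
    simp only [smul_eq_mul, add_sub_cancel_left, Real.norm_eq_abs] at hn
    have e1 : c / f * h n * f = c * h n := by field_simp
    rw [e1] at hn
    have hhn : 0 < h n := hh0 n
    calc |cdf (P.map (X 0)) (q + c / f * h n) - u - c * h n|
        ≤ δ * f / 8 * |c / f * h n| := hn
      _ = δ * h n / 8 * |c| := by
          rw [abs_mul, abs_div, abs_of_pos hf, abs_of_pos hhn]
          field_simp
      _ ≤ δ * h n / 8 * 2 := mul_le_mul_of_nonneg_left hc (by positivity)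
      _ = δ * h n / 4 := by ring
  have hc1 : |1 + δ| ≤ 2 := by rw [abs_of_pos (by linarith)]; linarith
  have hc2 : |1 - δ| ≤ 2 := by rw [abs_of_pos (by linarith)]; linarith
  have hc3 : |-(1 - δ)| ≤ 2 := by rw [abs_neg]; exact hc2
  have hc4 : |-(1 + δ)| ≤ 2 := by rw [abs_neg]; exact hc1
  -- the levels `u ± hₙ` are eventually inside `(0,1)`
  have hlev : ∀ᶠ n in atTop, h n < min u (1 - u) :=
    hh.eventually (gt_mem_nhds (lt_min hu0 (by linarith)))
  -- the bound on the bad event, for large `n`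
  have hbound : ∀ᶠ n : ℕ in atTop,
      P.real {ω | ε ≤ ‖(sInf {x | u + h n ≤
            (∑ i ∈ range n, (Set.Iic x).indicator (1 : ℝ → ℝ) (X i ω)) / n}
          - sInf {x | u - h n ≤
            (∑ i ∈ range n, (Set.Iic x).indicator (1 : ℝ → ℝ) (X i ω)) / n}) / (2 * h n)
          - 1 / f‖}
        ≤ 4 * Real.exp (-(2 * n * (δ * h n / 2) ^ 2)) := by
    filter_upwards [hexp (1 + δ) hc1, hexp (1 - δ) hc2, hexp (-(1 - δ)) hc3, hexp (-(1 + δ)) hc4,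
      hlev, eventually_ge_atTop 1] with n h1 h2 h3 h4 h5 h6
    have hhn : 0 < h n := hh0 n
    have h5a : h n < u := lt_of_lt_of_le h5 (min_le_left _ _)
    have h5b : h n < 1 - u := lt_of_lt_of_le h5 (min_le_right _ _)
    have hδh : 0 ≤ δ * h n / 2 := by positivity
    -- the four Hoeffding events
    have HB1 := measureReal_cdf_sub_edf_ge_le hXm hind hid (q + (1 + δ) / f * h n) hδh h6
    have HB2 := measureReal_edf_sub_cdf_ge_le hXm hind hid (q + (1 - δ) / f * h n) hδh h6
    have HB3 := measureReal_cdf_sub_edf_ge_le hXm hind hid (q + -(1 - δ) / f * h n) hδh h6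
    have HB4 := measureReal_edf_sub_cdf_ge_le hXm hind hid (q + -(1 + δ) / f * h n) hδh h6
    -- outside the four events the estimator is `ε`-close to `1/f`
    have hgood : ∀ ω,
        ω ∉ {ω | δ * h n / 2 ≤ cdf (P.map (X 0)) (q + (1 + δ) / f * h n)
            - (∑ i ∈ range n, (Set.Iic (q + (1 + δ) / f * h n)).indicator (1 : ℝ → ℝ)
                (X i ω)) / n} →
        ω ∉ {ω | δ * h n / 2 ≤ (∑ i ∈ range n,
              (Set.Iic (q + (1 - δ) / f * h n)).indicator (1 : ℝ → ℝ) (X i ω)) / n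
            - cdf (P.map (X 0)) (q + (1 - δ) / f * h n)} →
        ω ∉ {ω | δ * h n / 2 ≤ cdf (P.map (X 0)) (q + -(1 - δ) / f * h n)
            - (∑ i ∈ range n, (Set.Iic (q + -(1 - δ) / f * h n)).indicator (1 : ℝ → ℝ)
                (X i ω)) / n} →
        ω ∉ {ω | δ * h n / 2 ≤ (∑ i ∈ range n,
              (Set.Iic (q + -(1 + δ) / f * h n)).indicator (1 : ℝ → ℝ) (X i ω)) / n
            - cdf (P.map (X 0)) (q + -(1 + δ) / f * h n)} →
        ‖(sInf {x | u + h n ≤ (∑ i ∈ range n, (Set.Iic x).indicator (1 : ℝ → ℝ) (X i ω)) / n}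
          - sInf {x | u - h n ≤ (∑ i ∈ range n, (Set.Iic x).indicator (1 : ℝ → ℝ) (X i ω)) / n})
            / (2 * h n) - 1 / f‖ < ε := by
      intro ω g1 g2 g3 g4
      simp only [Set.mem_setOf_eq, not_le] at g1 g2 g3 g4
      rw [Real.norm_eq_abs]
      exact abs_spacing_sub_inv_lt_of_deviations (fun i => X i ω) h6 (cdf (P.map (X 0))) hhn hδ0
        hδε (by linarith) (by linarith) h1 h2 h3 h4 g1 g2 g3 g4
    -- name the four events and take the union bound
    set B1 : Set Ω := {ω | δ * h n / 2 ≤ cdf (P.map (X 0)) (q + (1 + δ) / f * h n)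
        - (∑ i ∈ range n, (Set.Iic (q + (1 + δ) / f * h n)).indicator (1 : ℝ → ℝ)
            (X i ω)) / n} with hB1
    set B2 : Set Ω := {ω | δ * h n / 2 ≤ (∑ i ∈ range n,
          (Set.Iic (q + (1 - δ) / f * h n)).indicator (1 : ℝ → ℝ) (X i ω)) / n
        - cdf (P.map (X 0)) (q + (1 - δ) / f * h n)} with hB2
    set B3 : Set Ω := {ω | δ * h n / 2 ≤ cdf (P.map (X 0)) (q + -(1 - δ) / f * h n)
        - (∑ i ∈ range n, (Set.Iic (q + -(1 - δ) / f * h n)).indicator (1 : ℝ → ℝ)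
            (X i ω)) / n} with hB3
    set B4 : Set Ω := {ω | δ * h n / 2 ≤ (∑ i ∈ range n,
          (Set.Iic (q + -(1 + δ) / f * h n)).indicator (1 : ℝ → ℝ) (X i ω)) / n
        - cdf (P.map (X 0)) (q + -(1 + δ) / f * h n)} with hB4
    have hincl : {ω | ε ≤ ‖(sInf {x | u + h n ≤
            (∑ i ∈ range n, (Set.Iic x).indicator (1 : ℝ → ℝ) (X i ω)) / n}
          - sInf {x | u - h n ≤
            (∑ i ∈ range n, (Set.Iic x).indicator (1 : ℝ → ℝ) (X i ω)) / n}) / (2 * h n)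
          - 1 / f‖} ⊆ ((B1 ∪ B2) ∪ B3) ∪ B4 := by
      intro ω hω
      by_contra hnot
      simp only [Set.mem_union, not_or] at hnot
      obtain ⟨⟨⟨g1, g2⟩, g3⟩, g4⟩ := hnot
      exact absurd hω (not_le.2 (hgood ω g1 g2 g3 g4))
    linarith [measureReal_mono hincl (measure_ne_top P _),
      measureReal_union_le (μ := P) ((B1 ∪ B2) ∪ B3) B4,
      measureReal_union_le (μ := P) (B1 ∪ B2) B3, measureReal_union_le (μ := P) B1 B2]
  -- the bound tends to zero
  have hlim : Tendsto (fun n : ℕ => 4 * Real.exp (-(2 * n * (δ * h n / 2) ^ 2))) atTop (𝓝 0) := by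
    have hg : Tendsto (fun n : ℕ => 2 * n * (δ * h n / 2) ^ 2) atTop atTop := by
      have := hnh.atTop_mul_const (show (0 : ℝ) < δ ^ 2 / 2 by positivity)
      refine this.congr' (Eventually.of_forall fun n => ?_)
      ring
    have := (Real.tendsto_exp_neg_atTop_nhds_zero.comp hg).const_mul 4
    simpa using this
  have hreal := squeeze_zero' (Eventually.of_forall fun n => measureReal_nonneg) hbound hlim
  have := ENNReal.tendsto_ofReal hreal
  rw [ENNReal.ofReal_zero] at this
  refine this.congr' (Eventually.of_forall fun n => ?_)
  exact ofReal_measureReal (measure_ne_top _ _)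

/-- **THE PLUG-IN SQUARED STANDARD ERROR OF A SAMPLE QUANTILE IS CONSISTENT.**  Same hypotheses;
with the spacing estimator `ŝₙ` of `quantileSpacing_tendstoInMeasure` and the printed squared
standard error `V̂ₙ = u(1−u)·ŝₙ²/n` of the sample `u`-quantile, `n·V̂ₙ → u(1−u)/f²` in
probability — the hypothesis of the two-code quantile agreement test. [ours] (continuous
mapping in probability, `DeltaMethod.tendstoInMeasure_comp_continuousAt`) -/
theorem sampleQuantile_pluginVariance_tendstoInMeasure (hXm : ∀ i, Measurable (X i))
    (hind : iIndepFun X P) (hid : ∀ i, IdentDistrib (X i) (X 0) P P) {u q f : ℝ}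
    (hu0 : 0 < u) (hu1 : u < 1) (hFq : cdf (P.map (X 0)) q = u)
    (hder : HasDerivAt (cdf (P.map (X 0))) f q) (hf : 0 < f) {h : ℕ → ℝ} (hh0 : ∀ n, 0 < h n)
    (hh : Tendsto h atTop (𝓝 0)) (hnh : Tendsto (fun n : ℕ => (n : ℝ) * h n ^ 2) atTop atTop) :
    TendstoInMeasure P (fun (n : ℕ) ω => (n : ℝ) * (u * (1 - u) *
        ((sInf {x | u + h n ≤ (∑ i ∈ range n, (Set.Iic x).indicator (1 : ℝ → ℝ) (X i ω)) / n}
          - sInf {x | u - h n ≤ (∑ i ∈ range n, (Set.Iic x).indicator (1 : ℝ → ℝ) (X i ω)) / n})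
          / (2 * h n)) ^ 2 / n)) atTop (fun _ => u * (1 - u) / f ^ 2) := by
  have hT := quantileSpacing_tendstoInMeasure hXm hind hid hu0 hu1 hFq hder hf hh0 hh hnh
  have hφ : ContinuousAt (fun s : ℝ => u * (1 - u) * s ^ 2) (1 / f) := by fun_prop
  have h2 := CardConsistency.tendstoInMeasure_comp_continuousAt hT hφ
  have hlim : u * (1 - u) * (1 / f) ^ 2 = u * (1 - u) / f ^ 2 := by
    field_simp
  simp only [hlim] at h2
  refine h2.congr' ?_ EventuallyEq.rfl
  filter_upwards [eventually_ge_atTop 1] with n hn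
  refine Eventually.of_forall fun ω => ?_
  have hn0 : (n : ℝ) ≠ 0 := by exact_mod_cast (by omega : n ≠ 0)
  beta_reduce
  rw [← mul_div_assoc, mul_div_cancel_left₀ _ hn0]

end Spacing

end Summit.Ventures.LatticeQCDFlow.Scoring.GlivenkoCantelli

end
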